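import Summits.BirchSwinnertonDyer.BirchSwinnertonDyer.Theorems.ErratumRoadFiveSigmaLocalMultInertia
import Summits.BirchSwinnertonDyer.BirchSwinnertonDyer.Theorems.ErratumRoadFiveSigmaLocalGoodCharpoly
import Literature.NumberTheory.GaloisRepresentations.DiscreteCochains
import Literature.NumberTheory.GaloisRepresentations.LocalOneUnitsProofs
import Mathlib.CategoryTheory.CofilteredSystem
import HarnessLib

/-!
# (S5-mult) the inertia-coinvariant quotient `Q = E[p^∞] ⧸ ⟨σa − a : σ ∈ I_w⟩` at a multiplicative
# place: `T_p(mkQ)` is onto, `T_p Q ≠ 0`, and Frobenius acts on `T_p Q` as `ε = ±1` (theorems only)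

Cell `bsd-stepL`, K2 route `ErratumRoadFive`, support item 20495 `JSWSigmaLocalCharIdeal`, step (S5) at
the finitely decomposed places of MULTIPLICATIVE reduction; seat `bsd-stepL-imc-p1` (g14). THEOREMS ONLY.

With `A = E[p^∞] = PrimaryTorsion (geomPoints E) p`, `ρw = (primaryTorsionGaloisRep p).restrict (localMap K (inl w))`,
`I = absInertia K_w` and `D = span_{ℤ_p} {ρw σ a − a : σ ∈ I}` (the kernel of `A → A_I`), the quotient
`Q = A ⧸ D` (`ContinuousRep.quotient`) is a discrete `p`-primary `Γ_{K_w}`-module on which `I` acts TRIVIALLY;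
at a multiplicative `w ∤ p`:

* §1 generic: `tateModule_map_surjective_of_levelwise` (Kőnig: a levelwise-surjective map of `p`-primary
  modules with finite levels is surjective on Tate modules), `continuousSMul_padicInt_of_discrete` (a discrete
  `p`-primary `ℤ_p`-module is a topological `ℤ_p`-module);
* §2: `coinvSpan_le_comap` (`D` is `Γ_{K_w}`-stable), `quotient_absInertia_apply` (`I` acts trivially on `Q`),
  `exists_pow_nsmul_eq_of_mem_coinvSpan` (`D` is `p`-divisible), `tateModule_mkQ_surjective` (`T_p A ↠ T_p Q`),
  `tateModule_quotient_frob_eq` (**`T_p(ρ_Q φ) = T_p(ε·1)` on `T_p Q`**, from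
  `exists_smul_frob_sub_smul_mem_span`), `exists_tateModule_quotient_ne_zero` (**`T_p Q ≠ 0`**, from
  `exists_absInertia_primaryTorsionGaloisRep_ne` and `(τ−1)(σ−1) = 0`), finiteness of `Q[p^k]`.

References: [GreenbergVatsal2000] §2, proof of Prop. 2.4 (arXiv p. 22: `H¹(I_ℓ, A) ≅ A_{I_ℓ}(−1)`);
[SilvermanATAEC1994] Ex. 5.13; [SerreTate1968] §3.
-/

noncomputable section

open scoped Classical TensorProduct
open CategoryTheory Opposite Polynomial Field NumberField IsDedekindDomain WeierstrassCurve Module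
open Literature.NumberTheory.EllipticCurves Literature.NumberTheory.GaloisRepresentations
  Literature.NumberTheory.EllipticCurves.BigGaloisRep
  Literature.NumberTheory.GaloisRepresentations.IsNonarchimedeanLocalField

set_option autoImplicit false
-- the Theorems namespace of this sub repeats the summit name by design (D-0017 nested layout)
set_option linter.dupNamespace false

namespace Summit.BirchSwinnertonDyer.BirchSwinnertonDyer.Theorems.SigmaLocal

/-! ## §1 Generic lemmas -/

section Generic

variable {p : ℕ} [Fact p.Prime]

/-- In a `ℤ_p`-module, a scalar acts on an element killed by `p^n` through its residue mod `p^n`.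
[folklore] -/
theorem padicInt_smul_eq_val_toZModPow_smul {M : Type*} [AddCommGroup M] [Module ℤ_[p] M]
    (c : ℤ_[p]) {y : M} {n : ℕ} (hy : p ^ n • y = 0) :
    c • y = (PadicInt.toZModPow n c).val • y := by
  have hker : c - ((PadicInt.toZModPow n c).val : ℤ_[p]) ∈ RingHom.ker (PadicInt.toZModPow n) := by
    rw [RingHom.mem_ker, map_sub, map_natCast, ZMod.natCast_zmod_val, sub_self]
  rw [PadicInt.ker_toZModPow, Ideal.mem_span_singleton'] at hker
  obtain ⟨d, hd⟩ := hker
  have hc : c = ((PadicInt.toZModPow n c).val : ℤ_[p]) + d * (p : ℤ_[p]) ^ n := by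
    rw [hd]; ring
  calc c • y = (((PadicInt.toZModPow n c).val : ℤ_[p]) + d * (p : ℤ_[p]) ^ n) • y := by rw [← hc]
    _ = (PadicInt.toZModPow n c).val • y := by
        rw [add_smul, Nat.cast_smul_eq_nsmul, mul_smul, ← Nat.cast_pow, Nat.cast_smul_eq_nsmul, hy,
          smul_zero, add_zero]

omit [Fact p.Prime] in
/-- `p^k • a_{n+k} = a_n` for an element of `T_p B`. [folklore] -/
theorem pow_smul_proj_add {B : Type*} [AddCommGroup B] (y : TateModule B p) (n k : ℕ) :
    p ^ k • TateModule.proj p (n + k) y = TateModule.proj p n y := by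
  induction k with
  | zero => rw [pow_zero, one_smul, Nat.add_zero]
  | succ k ih =>
    rw [pow_succ, mul_smul, ← Nat.add_assoc, TateModule.smul_proj_succ, ih]

omit [Fact p.Prime] in
/-- `p^(j − i) • a_j = a_i` for `i ≤ j`. [folklore] -/
theorem pow_sub_smul_proj {B : Type*} [AddCommGroup B] (y : TateModule B p) {i j : ℕ} (h : i ≤ j) :
    p ^ (j - i) • TateModule.proj p j y = TateModule.proj p i y := by
  obtain ⟨k, rfl⟩ := Nat.exists_eq_add_of_le h
  rw [Nat.add_sub_cancel_left, pow_smul_proj_add]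

/-- **Kőnig for Tate modules.** If `f : A → B` is levelwise surjective on `p`-power torsion
(`B[p^n] ⊆ f(A[p^n])`) and the levels `A[p^n]` are finite, then `T_p f : T_p A → T_p B` is surjective
(the fibres over a compatible sequence form an inverse system of non-empty finite sets).
[folklore] -/
theorem tateModule_map_surjective_of_levelwise {A B : Type*} [AddCommGroup A] [AddCommGroup B]
    (f : A →+ B) (hfin : ∀ n : ℕ, Set.Finite {a : A | p ^ n • a = 0})
    (hs : ∀ (n : ℕ) (b : B), p ^ n • b = 0 → ∃ a : A, p ^ n • a = 0 ∧ f a = b) :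
    Function.Surjective (TateModule.map p f) := by
  intro y
  -- the inverse system of fibres
  let Fn : ℕᵒᵖ ⥤ Type _ :=
    { obj := fun j => {a : A // p ^ j.unop • a = 0 ∧ f a = TateModule.proj p j.unop y}
      map := fun {j j'} g => TypeCat.ofHom fun x =>
        ⟨p ^ (j.unop - j'.unop) • x.1, by
          refine ⟨?_, ?_⟩
          · rw [← mul_smul, ← pow_add, Nat.add_sub_cancel' (leOfHom g.unop), x.2.1]
          · rw [map_nsmul, x.2.2, pow_sub_smul_proj y (leOfHom g.unop)]⟩
      map_id := fun j => by
        refine ConcreteCategory.hom_ext _ _ fun x => Subtype.ext ?_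
        change p ^ (j.unop - j.unop) • x.1 = x.1
        rw [Nat.sub_self, pow_zero, one_smul]
      map_comp := fun {j j' j''} g g' => by
        refine ConcreteCategory.hom_ext _ _ fun x => Subtype.ext ?_
        change p ^ (j.unop - j''.unop) • x.1 = p ^ (j'.unop - j''.unop) • (p ^ (j.unop - j'.unop) • x.1)
        rw [← mul_smul, ← pow_add, add_comm, Nat.sub_add_sub_cancel (leOfHom g.unop) (leOfHom g'.unop)] }
  haveI : ∀ j : ℕᵒᵖ, Finite (Fn.obj j) := fun j => by
    haveI := (hfin j.unop).to_subtype
    exact Finite.of_injective (fun x : Fn.obj j => (⟨x.1, x.2.1⟩ : {a : A | p ^ j.unop • a = 0}))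
      fun x x' h => by
        have h' : (⟨x.1, x.2.1⟩ : {a : A | p ^ j.unop • a = 0}) = ⟨x'.1, x'.2.1⟩ := h
        have h'' := congrArg Subtype.val h'
        exact Subtype.ext h''
  haveI : ∀ j : ℕᵒᵖ, Nonempty (Fn.obj j) := fun j => by
    obtain ⟨a, ha, hfa⟩ := hs j.unop (TateModule.proj p j.unop y) (TateModule.pow_smul_proj _ y)
    exact ⟨⟨a, ha, hfa⟩⟩
  obtain ⟨sec, hsec⟩ := nonempty_sections_of_finite_inverse_system Fn
  have hstep : ∀ n : ℕ, p • (sec (op (n + 1))).1 = (sec (op n)).1 := fun n => by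
    have h := congrArg Subtype.val (hsec (homOfLE (Nat.le_succ n)).op)
    change p ^ (n + 1 - n) • (sec (op (n + 1))).1 = (sec (op n)).1 at h
    rwa [Nat.add_sub_cancel_left, pow_one] at h
  refine ⟨TateModule.mk (fun n => (sec (op n)).1) (fun n => (sec (op n)).2.1) hstep,
    TateModule.ext fun n => ?_⟩
  rw [TateModule.proj_map, TateModule.proj_mk]
  exact (sec (op n)).2.2

/-- **A discrete `p`-primary `ℤ_p`-module is a topological `ℤ_p`-module** (the orbit map of `m`, killed by
`p^k`, factors through the continuous `ℤ_p → ℤ/p^k`). [folklore] -/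
theorem continuousSMul_padicInt_of_discrete {M : Type*} [AddCommGroup M] [Module ℤ_[p] M]
    [TopologicalSpace M] [DiscreteTopology M] (hM : ∀ m : M, ∃ k : ℕ, p ^ k • m = 0) :
    ContinuousSMul ℤ_[p] M := by
  refine ⟨continuous_prod_of_discrete_right.mpr fun m => ?_⟩
  obtain ⟨k, hk⟩ := hM m
  have : (fun c : ℤ_[p] => c • m) = fun c => (PadicInt.toZModPow k c).val • m :=
    funext fun c => padicInt_smul_eq_val_toZModPow_smul c hk
  change Continuous fun c : ℤ_[p] => c • m
  rw [this]
  exact (continuous_of_discreteTopology (f := fun i : ZMod (p ^ k) => i.val • m)).comp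
    (PadicInt.continuous_toZModPow p k)

/-- The quotient map is levelwise surjective on `p`-power torsion when the kernel is `p`-divisible.
[folklore] -/
theorem exists_torsion_lift_mkQ {M : Type*} [AddCommGroup M] [Module ℤ_[p] M] (W : Submodule ℤ_[p] M)
    (hW : ∀ (n : ℕ) (w : M), w ∈ W → ∃ w' ∈ W, p ^ n • w' = w) (n : ℕ) (q : M ⧸ W)
    (hq : p ^ n • q = 0) : ∃ m : M, p ^ n • m = 0 ∧ W.mkQ m = q := by
  obtain ⟨m, rfl⟩ := W.mkQ_surjective q
  have hmem : p ^ n • m ∈ W := by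
    rw [← Submodule.Quotient.mk_eq_zero, ← Submodule.mkQ_apply, map_nsmul]; exact hq
  obtain ⟨w', hw', hw'eq⟩ := hW n _ hmem
  refine ⟨m - w', by rw [smul_sub, hw'eq, sub_self], ?_⟩
  rw [map_sub, (Submodule.Quotient.mk_eq_zero W).mpr hw' |> fun h => show W.mkQ w' = 0 from h, sub_zero]

end Generic

/-! ## §2 The inertia-coinvariant quotient of `E[p^∞]` at a multiplicative place -/

section Quotient

variable {K : Type} [Field K] [NumberField K] (E : WeierstrassCurve K) [E.IsElliptic]
  (p : ℕ) [Fact p.Prime] {w : HeightOneSpectrum (𝓞 K)}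

omit [E.IsElliptic] in
/-- **`D = ⟨σa − a : σ ∈ I_w⟩` is `Γ_{K_w}`-stable** (`I_w` is normal in `Γ_{K_w}`):
`ρ(g)(ρ(σ)a − a) = ρ(gσg⁻¹)(ρ(g)a) − ρ(g)a`. [folklore] -/
theorem coinvSpan_le_comap (g : absoluteGaloisGroup (w.adicCompletion K)) :
    (Submodule.span ℤ_[p] {x : PrimaryTorsion (geomPoints E) p |
        ∃ σ ∈ absInertia (w.adicCompletion K), ∃ a, x = ((E.primaryTorsionGaloisRep p).restrict (localMap K (Sum.inl w)) :
        ContinuousRep (absoluteGaloisGroup (w.adicCompletion K)) ℤ_[p] (PrimaryTorsion (geomPoints E) p)) σ a - a}) ≤ (Submodule.span ℤ_[p] {x : PrimaryTorsion (geomPoints E) p |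
        ∃ σ ∈ absInertia (w.adicCompletion K), ∃ a, x = ((E.primaryTorsionGaloisRep p).restrict (localMap K (Sum.inl w)) :
        ContinuousRep (absoluteGaloisGroup (w.adicCompletion K)) ℤ_[p] (PrimaryTorsion (geomPoints E) p)) σ a - a}).comap (((E.primaryTorsionGaloisRep p).restrict (localMap K (Sum.inl w)) :
        ContinuousRep (absoluteGaloisGroup (w.adicCompletion K)) ℤ_[p] (PrimaryTorsion (geomPoints E) p)) g) := by
  set ρ' : ContinuousRep (absoluteGaloisGroup (w.adicCompletion K)) ℤ_[p] (PrimaryTorsion (geomPoints E) p) :=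
    (E.primaryTorsionGaloisRep p).restrict (localMap K (Sum.inl w)) with hρ'
  haveI hnormal : (absInertia (w.adicCompletion K)).Normal := absInertia_normal_holds (w.adicCompletion K)
  rw [Submodule.span_le]
  rintro _ ⟨σ, hσ, a, rfl⟩
  rw [SetLike.mem_coe, Submodule.mem_comap]
  refine Submodule.subset_span ⟨g * σ * g⁻¹, hnormal.conj_mem σ hσ g, ρ' g a, ?_⟩
  have h1 : ρ' (g * σ * g⁻¹) (ρ' g a) = ρ' g (ρ' σ a) := by
    rw [← Module.End.mul_apply, ← map_mul, inv_mul_cancel_right, map_mul, Module.End.mul_apply]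
  rw [h1, map_sub]

omit [E.IsElliptic] in
/-- **`I_w` acts trivially on `Q = E[p^∞] ⧸ D`.** [cite: GreenbergVatsal2000, §2, proof of Prop. 2.4 (arXiv p. 22: `A_{I_ℓ}`)] -/
theorem quotient_apply_eq_of_mem_absInertia {σ : absoluteGaloisGroup (w.adicCompletion K)}
    (hσ : σ ∈ absInertia (w.adicCompletion K))
    (q : PrimaryTorsion (geomPoints E) p ⧸ (Submodule.span ℤ_[p] {x : PrimaryTorsion (geomPoints E) p |
        ∃ σ ∈ absInertia (w.adicCompletion K), ∃ a, x = ((E.primaryTorsionGaloisRep p).restrict (localMap K (Sum.inl w)) :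
        ContinuousRep (absoluteGaloisGroup (w.adicCompletion K)) ℤ_[p] (PrimaryTorsion (geomPoints E) p)) σ a - a})) :
    (((E.primaryTorsionGaloisRep p).restrict (localMap K (Sum.inl w)) :
        ContinuousRep (absoluteGaloisGroup (w.adicCompletion K)) ℤ_[p] (PrimaryTorsion (geomPoints E) p))).quotient (Submodule.span ℤ_[p] {x : PrimaryTorsion (geomPoints E) p |
        ∃ σ ∈ absInertia (w.adicCompletion K), ∃ a, x = ((E.primaryTorsionGaloisRep p).restrict (localMap K (Sum.inl w)) :
        ContinuousRep (absoluteGaloisGroup (w.adicCompletion K)) ℤ_[p] (PrimaryTorsion (geomPoints E) p)) σ a - a}) (coinvSpan_le_comap E p) σ q = q := by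
  induction q using Submodule.Quotient.induction_on with
  | _ a =>
    rw [ContinuousRep.quotient_apply_mk]
    exact (Submodule.Quotient.eq _).mpr (Submodule.subset_span ⟨σ, hσ, a, rfl⟩)

omit [E.IsElliptic] in
/-- `D` is `p`-divisible (as is `E[p^∞]`). [cite: SilvermanAEC2009, §VIII.2 (`[m]` is onto `E(K̄)`)] -/
theorem exists_pow_nsmul_eq_of_mem_coinvSpan (n : ℕ) (x : PrimaryTorsion (geomPoints E) p)
    (hx : x ∈ (Submodule.span ℤ_[p] {x : PrimaryTorsion (geomPoints E) p |
        ∃ σ ∈ absInertia (w.adicCompletion K), ∃ a, x = ((E.primaryTorsionGaloisRep p).restrict (localMap K (Sum.inl w)) :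
        ContinuousRep (absoluteGaloisGroup (w.adicCompletion K)) ℤ_[p] (PrimaryTorsion (geomPoints E) p)) σ a - a})) : ∃ x' ∈ (Submodule.span ℤ_[p] {x : PrimaryTorsion (geomPoints E) p |
        ∃ σ ∈ absInertia (w.adicCompletion K), ∃ a, x = ((E.primaryTorsionGaloisRep p).restrict (localMap K (Sum.inl w)) :
        ContinuousRep (absoluteGaloisGroup (w.adicCompletion K)) ℤ_[p] (PrimaryTorsion (geomPoints E) p)) σ a - a}), p ^ n • x' = x := by
  set ρ' : ContinuousRep (absoluteGaloisGroup (w.adicCompletion K)) ℤ_[p] (PrimaryTorsion (geomPoints E) p) :=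
    (E.primaryTorsionGaloisRep p).restrict (localMap K (Sum.inl w)) with hρ'
  induction hx using Submodule.span_induction with
  | mem x hx =>
    obtain ⟨σ, hσ, a, rfl⟩ := hx
    obtain ⟨b, rfl⟩ := E.exists_prime_pow_nsmul_eq_primaryTorsion p n a
    exact ⟨ρ' σ b - b, Submodule.subset_span ⟨σ, hσ, b, rfl⟩, by rw [nsmul_sub, map_nsmul]⟩
  | zero => exact ⟨0, Submodule.zero_mem _, smul_zero _⟩
  | add x y _ _ hx hy =>
    obtain ⟨x', hx', rfl⟩ := hx
    obtain ⟨y', hy', rfl⟩ := hy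
    exact ⟨x' + y', Submodule.add_mem _ hx' hy', smul_add _ _ _⟩
  | smul c x _ hx =>
    obtain ⟨x', hx', rfl⟩ := hx
    exact ⟨c • x', Submodule.smul_mem _ c hx', smul_comm _ _ _⟩

/-- **`T_p(E[p^∞]) → T_p(Q)` is surjective** (levelwise surjective with finite levels; Kőnig). [folklore] -/
theorem tateModule_mkQ_surjective :
    Function.Surjective (TateModule.map p ((Submodule.span ℤ_[p] {x : PrimaryTorsion (geomPoints E) p |
        ∃ σ ∈ absInertia (w.adicCompletion K), ∃ a, x = ((E.primaryTorsionGaloisRep p).restrict (localMap K (Sum.inl w)) :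
        ContinuousRep (absoluteGaloisGroup (w.adicCompletion K)) ℤ_[p] (PrimaryTorsion (geomPoints E) p)) σ a - a})).mkQ.toAddMonoidHom) :=
  tateModule_map_surjective_of_levelwise _ (primaryTorsion_setOf_pow_nsmul_eq_zero_finite E p)
    fun n q hq => exists_torsion_lift_mkQ _ (exists_pow_nsmul_eq_of_mem_coinvSpan E p) n q hq

/-- `Q[p^k]` is finite (image of `E[p^∞][p^k]`). [cite: SilvermanAEC2009, Cor. III.6.4] -/
theorem quotient_setOf_pow_nsmul_eq_zero_finite (k : ℕ) :
    Set.Finite {q : PrimaryTorsion (geomPoints E) p ⧸ (Submodule.span ℤ_[p] {x : PrimaryTorsion (geomPoints E) p |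
        ∃ σ ∈ absInertia (w.adicCompletion K), ∃ a, x = ((E.primaryTorsionGaloisRep p).restrict (localMap K (Sum.inl w)) :
        ContinuousRep (absoluteGaloisGroup (w.adicCompletion K)) ℤ_[p] (PrimaryTorsion (geomPoints E) p)) σ a - a}) | p ^ k • q = 0} := by
  refine ((primaryTorsion_setOf_pow_nsmul_eq_zero_finite E p k).image ((Submodule.span ℤ_[p] {x : PrimaryTorsion (geomPoints E) p |
        ∃ σ ∈ absInertia (w.adicCompletion K), ∃ a, x = ((E.primaryTorsionGaloisRep p).restrict (localMap K (Sum.inl w)) :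
        ContinuousRep (absoluteGaloisGroup (w.adicCompletion K)) ℤ_[p] (PrimaryTorsion (geomPoints E) p)) σ a - a})).mkQ).subset fun q hq => ?_
  obtain ⟨m, hm, hmq⟩ := exists_torsion_lift_mkQ _ (exists_pow_nsmul_eq_of_mem_coinvSpan E p) k q hq
  exact ⟨m, hm, hmq⟩

omit [E.IsElliptic] in
/-- `Q` is `p`-primary. [cite: Serre1968, Ch. I §1.2] -/
theorem quotient_exists_pow_nsmul_eq_zero (q : PrimaryTorsion (geomPoints E) p ⧸ (Submodule.span ℤ_[p] {x : PrimaryTorsion (geomPoints E) p |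
        ∃ σ ∈ absInertia (w.adicCompletion K), ∃ a, x = ((E.primaryTorsionGaloisRep p).restrict (localMap K (Sum.inl w)) :
        ContinuousRep (absoluteGaloisGroup (w.adicCompletion K)) ℤ_[p] (PrimaryTorsion (geomPoints E) p)) σ a - a})) :
    ∃ k : ℕ, p ^ k • q = 0 := by
  induction q using Submodule.Quotient.induction_on with
  | _ a =>
    obtain ⟨k, hk⟩ := primaryTorsion_exists_pow_nsmul_eq_zero E p a
    refine ⟨k, ?_⟩
    change p ^ k • (Submodule.mkQ _ a) = 0
    rw [← map_nsmul, hk, map_zero]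

/-- Every element of `D` is `I_w`-fixed at a multiplicative `w ∤ p` (`(τ − 1)(σ − 1) = 0`).
[cite: SilvermanATAEC1994, Ex. 5.13 (b)] -/
theorem apply_eq_self_of_mem_coinvSpan
    (hw : ((p : ℕ) : 𝓞 K) ∉ w.asIdeal) (hv : E.HasMultiplicativeReductionAt w)
    {τ : absoluteGaloisGroup (w.adicCompletion K)} (hτ : τ ∈ absInertia (w.adicCompletion K))
    {x : PrimaryTorsion (geomPoints E) p} (hx : x ∈ (Submodule.span ℤ_[p] {x : PrimaryTorsion (geomPoints E) p |
        ∃ σ ∈ absInertia (w.adicCompletion K), ∃ a, x = ((E.primaryTorsionGaloisRep p).restrict (localMap K (Sum.inl w)) :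
        ContinuousRep (absoluteGaloisGroup (w.adicCompletion K)) ℤ_[p] (PrimaryTorsion (geomPoints E) p)) σ a - a})) : ((E.primaryTorsionGaloisRep p).restrict (localMap K (Sum.inl w)) :
        ContinuousRep (absoluteGaloisGroup (w.adicCompletion K)) ℤ_[p] (PrimaryTorsion (geomPoints E) p)) τ x = x := by
  set ρ' : ContinuousRep (absoluteGaloisGroup (w.adicCompletion K)) ℤ_[p] (PrimaryTorsion (geomPoints E) p) :=
    (E.primaryTorsionGaloisRep p).restrict (localMap K (Sum.inl w)) with hρ'
  induction hx using Submodule.span_induction with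
  | mem x hx =>
    obtain ⟨σ, hσ, a, rfl⟩ := hx
    exact primaryTorsionGaloisRep_inertia_smul_sub_eq E p hw hv hτ hσ a
  | zero => exact map_zero _
  | add x y _ _ hx hy => rw [map_add, hx, hy]
  | smul c x _ hx => rw [map_smul, hx]

/-- **`T_p Q ≠ 0`** at a multiplicative `w ∤ p`: an `E[p^∞]`-point moved by inertia
(`exists_absInertia_primaryTorsionGaloisRep_ne`) is not in `D ⊆ E[p^∞]^{I_w}`, and its class lifts to
`T_p Q` along `T_p(E[p^∞]) ↠ T_p Q`. [cite: SilvermanATAEC1994, Thm. IV.10.2(a) (multiplicative case)] -/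
theorem exists_tateModule_quotient_ne_zero
    (hw : ((p : ℕ) : 𝓞 K) ∉ w.asIdeal) (hv : E.HasMultiplicativeReductionAt w) :
    ∃ t : TateModule (PrimaryTorsion (geomPoints E) p ⧸ (Submodule.span ℤ_[p] {x : PrimaryTorsion (geomPoints E) p |
        ∃ σ ∈ absInertia (w.adicCompletion K), ∃ a, x = ((E.primaryTorsionGaloisRep p).restrict (localMap K (Sum.inl w)) :
        ContinuousRep (absoluteGaloisGroup (w.adicCompletion K)) ℤ_[p] (PrimaryTorsion (geomPoints E) p)) σ a - a})) p, t ≠ 0 := by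
  set ρ' : ContinuousRep (absoluteGaloisGroup (w.adicCompletion K)) ℤ_[p] (PrimaryTorsion (geomPoints E) p) :=
    (E.primaryTorsionGaloisRep p).restrict (localMap K (Sum.inl w)) with hρ'
  set D := (Submodule.span ℤ_[p] {x : PrimaryTorsion (geomPoints E) p |
        ∃ σ ∈ absInertia (w.adicCompletion K), ∃ a, x = ρ' σ a - a}) with hD
  obtain ⟨σ, hσ, a, ha⟩ := exists_absInertia_primaryTorsionGaloisRep_ne E p hw hv
  have hnot : a ∉ D := fun h => ha (apply_eq_self_of_mem_coinvSpan E p hw hv hσ h)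
  -- lift `a` to `T_p(E[p^∞])`
  obtain ⟨n, hn⟩ := a.exists_pow_smul_eq_zero
  have ha' : (a : geomPoints E) ∈ geomTorsion E ((p ^ n : ℕ) : ℤ) := by
    rw [mem_geomTorsion_iff, natCast_zsmul]; exact hn
  obtain ⟨x, hx⟩ := proj_surjective_of_isAlgClosed_holds E p n ha'
  obtain ⟨e8, he8⟩ := TateModule.exists_linearEquiv_primaryTorsion (geomPoints E) p
  have hs : TateModule.proj p n (e8.symm x) = a := by
    apply PrimaryTorsion.ext
    rw [← he8, LinearEquiv.apply_symm_apply, hx]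
  refine ⟨TateModule.map p D.mkQ.toAddMonoidHom (e8.symm x), fun h0 => hnot ?_⟩
  have := congrArg (TateModule.proj p n) h0
  rw [TateModule.proj_map, hs, map_zero, LinearMap.toAddMonoidHom_coe, Submodule.mkQ_apply,
    Submodule.Quotient.mk_eq_zero] at this
  exact this

/-- **Frobenius acts on `T_p Q` as the scalar `ε`** (`ε = 1` split, `ε = −1` non-split) at a
multiplicative `w ∤ p`: `T_p(ρ_Q(φ)) t = ε • t` for a local Frobenius `φ` (`IsFrobPow φ 1`). From
`exists_smul_frob_sub_smul_mem_span` (on `T_p E`, transported along `T_p(E[p^∞]) = T_p E`), the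
surjection `T_p(E[p^∞]) ↠ T_p Q`, the triviality of `I_w` on `Q`, and torsion-freeness of `T_p Q`.
[cite: GreenbergVatsal2000, §2, proof of Prop. 2.4 (arXiv p. 22)] [cite: SilvermanATAEC1994, Thm. V.5.3, Ex. 5.11 (b), 5.13 (a)] -/
theorem tateModule_quotient_frob_eq
    (hw : ((p : ℕ) : 𝓞 K) ∉ w.asIdeal) (hv : E.HasMultiplicativeReductionAt w)
    {φ : absoluteGaloisGroup (w.adicCompletion K)} (hφ : IsFrobPow φ 1) {ε : ℤ_[p]}
    (hε : (E.HasSplitMultiplicativeReductionAt w ∧ ε = 1) ∨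
      (¬ E.HasSplitMultiplicativeReductionAt w ∧ ε = -1))
    (t : TateModule (PrimaryTorsion (geomPoints E) p ⧸ (Submodule.span ℤ_[p] {x : PrimaryTorsion (geomPoints E) p |
        ∃ σ ∈ absInertia (w.adicCompletion K), ∃ a, x = ((E.primaryTorsionGaloisRep p).restrict (localMap K (Sum.inl w)) :
        ContinuousRep (absoluteGaloisGroup (w.adicCompletion K)) ℤ_[p] (PrimaryTorsion (geomPoints E) p)) σ a - a})) p) :
    TateModule.map p ((((E.primaryTorsionGaloisRep p).restrict (localMap K (Sum.inl w)) :
        ContinuousRep (absoluteGaloisGroup (w.adicCompletion K)) ℤ_[p] (PrimaryTorsion (geomPoints E) p))).quotient (Submodule.span ℤ_[p] {x : PrimaryTorsion (geomPoints E) p |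
        ∃ σ ∈ absInertia (w.adicCompletion K), ∃ a, x = ((E.primaryTorsionGaloisRep p).restrict (localMap K (Sum.inl w)) :
        ContinuousRep (absoluteGaloisGroup (w.adicCompletion K)) ℤ_[p] (PrimaryTorsion (geomPoints E) p)) σ a - a}) (coinvSpan_le_comap E p) φ).toAddMonoidHom t =
      ε • t := by
  have hquot := fun {σ} (hσ : σ ∈ absInertia (w.adicCompletion K)) => quotient_apply_eq_of_mem_absInertia E p hσ
  obtain ⟨s, rfl⟩ := tateModule_mkQ_surjective E p t
  set ρ' : ContinuousRep (absoluteGaloisGroup (w.adicCompletion K)) ℤ_[p] (PrimaryTorsion (geomPoints E) p) :=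
    (E.primaryTorsionGaloisRep p).restrict (localMap K (Sum.inl w)) with hρ'
  set D := (Submodule.span ℤ_[p] {x : PrimaryTorsion (geomPoints E) p |
        ∃ σ ∈ absInertia (w.adicCompletion K), ∃ a, x = ρ' σ a - a}) with hD
  set ρQ : ContinuousRep (absoluteGaloisGroup (w.adicCompletion K)) ℤ_[p] (PrimaryTorsion (geomPoints E) p ⧸ D) :=
    ρ'.quotient D (coinvSpan_le_comap E p) with hρQ
  obtain ⟨e8, he8⟩ := TateModule.exists_linearEquiv_primaryTorsion (geomPoints E) p
  obtain ⟨d, hd, hmem⟩ := exists_smul_frob_sub_smul_mem_span E p hw hv hφ hε (e8 s)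
  -- transport from `T_p E` to `T_p(E[p^∞])` along `e8`
  have hnat : ∀ (g : absoluteGaloisGroup (w.adicCompletion K)) (u : TateModule (PrimaryTorsion (geomPoints E) p) p),
      e8.symm (localMap K (Sum.inl w) g • e8 u) = TateModule.map p (ρ' g).toAddMonoidHom u := by
    intro g u
    apply e8.injective
    rw [LinearEquiv.apply_symm_apply, TateModule.linearEquiv_primaryTorsion_map e8 he8
      (ρ' g).toAddMonoidHom (DistribSMul.toAddMonoidHom (geomPoints E) (localMap K (Sum.inl w) g))
      (fun _ => rfl)]
    exact TateModule.ext fun k => by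
      rw [TateModule.proj_smul_of_distribMulAction, TateModule.proj_map]; rfl
  set πT := TateModule.map p D.mkQ.toAddMonoidHom with hπT
  -- `π_T` kills the inertia differences
  have hkill : Submodule.span ℤ_[p] {y : E.tateModule p | ∃ τ ∈ absInertia (w.adicCompletion K),
      ∃ x' : E.tateModule p, y = localMap K (Sum.inl w) τ • x' - x'} ≤
      LinearMap.ker (πT ∘ₗ e8.symm.toLinearMap) := by
    refine Submodule.span_le.mpr ?_
    rintro _ ⟨τ, hτ, x', rfl⟩
    rw [SetLike.mem_coe, LinearMap.mem_ker, LinearMap.comp_apply, LinearEquiv.coe_toLinearMap,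
      map_sub, map_sub, ← e8.apply_symm_apply x', hnat, LinearEquiv.symm_apply_apply, sub_eq_zero, hπT,
      ← LinearMap.comp_apply, ← TateModule.map_comp]
    refine TateModule.ext fun k => ?_
    rw [TateModule.proj_map, TateModule.proj_map, AddMonoidHom.comp_apply, LinearMap.toAddMonoidHom_coe,
      LinearMap.toAddMonoidHom_coe, Submodule.mkQ_apply, Submodule.mkQ_apply,
      ← ContinuousRep.quotient_apply_mk ρ' D (coinvSpan_le_comap E p), hquot hτ]
  -- `π_T` intertwines `ρ(φ)` with `ρ_Q(φ)`
  have hφQ : πT (TateModule.map p (ρ' φ).toAddMonoidHom s) = TateModule.map p (ρQ φ).toAddMonoidHom (πT s) := by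
    rw [hπT, ← LinearMap.comp_apply, ← TateModule.map_comp, ← LinearMap.comp_apply, ← TateModule.map_comp]
    rfl
  -- conclude by torsion-freeness
  have h1 : πT (e8.symm (d • (localMap K (Sum.inl w) φ • e8 s - ε • e8 s))) = 0 := by
    have := hkill hmem
    rwa [LinearMap.mem_ker] at this
  have h2 : e8.symm (d • (localMap K (Sum.inl w) φ • e8 s - ε • e8 s)) =
      d • (TateModule.map p (ρ' φ).toAddMonoidHom s - ε • s) := by
    rw [e8.symm.map_smul d, map_sub e8.symm, hnat, e8.symm.map_smul ε, LinearEquiv.symm_apply_apply]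
  rw [h2, πT.map_smul d, map_sub πT, πT.map_smul ε, hφQ, smul_eq_zero_iff_right hd, sub_eq_zero] at h1
  exact h1

omit [E.IsElliptic] in
/-- `Q` is a topological `ℤ_p`-module (discrete, `p`-primary). [folklore] -/
theorem continuousSMul_quotient :
    ContinuousSMul ℤ_[p] (PrimaryTorsion (geomPoints E) p ⧸ (Submodule.span ℤ_[p] {x : PrimaryTorsion (geomPoints E) p |
        ∃ σ ∈ absInertia (w.adicCompletion K), ∃ a, x = ((E.primaryTorsionGaloisRep p).restrict (localMap K (Sum.inl w)) :
        ContinuousRep (absoluteGaloisGroup (w.adicCompletion K)) ℤ_[p] (PrimaryTorsion (geomPoints E) p)) σ a - a})) :=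
  continuousSMul_padicInt_of_discrete (quotient_exists_pow_nsmul_eq_zero E p)

end Quotient

end Summit.BirchSwinnertonDyer.BirchSwinnertonDyer.Theorems.SigmaLocal

end
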